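import Literature.MathematicalPhysics.QuantumLattice.SectorisedIncrementBoundGradedWeightedPrescribedPlateau
import Literature.MathematicalPhysics.QuantumLattice.SectorisedIncrementBoundBinomialPrescribedPlateau
import Literature.MathematicalPhysics.QuantumLattice.GrassmannWeightedGaussConvBinomialGramPrescribed
import HarnessLib

/-!
# The FIRST ORDER of the sectorised single-scale increment in binomial–Gram form, PRESCRIBED output legs and WEIGHTED output positions
# (the weighted ALL-KNOWN track), plateau transport

Topic `MathematicalPhysics/QuantumLattice`; companion of `SectorisedIncrementBoundGradedWeightedPrescribedPlateau` (orders `≥ 2`) and common twin of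
`SectorisedIncrementBoundBinomialWeightedPlateau` / `SectorisedIncrementBoundBinomialPrescribedPlateau`.  The abstract supplier is in the tree:
`GrassmannWeightedGaussConvBinomialGramPrescribed.sum_wt_norm_kernel_gaussConv_sub_le_binomial_prescribed_of_gramBounded` (the linear part `e^{Δ_C}H − H` kernel by
kernel, one output leg pinned, legs `j ∈ J` constrained, the other legs summed against a tree weight; the input through its WEIGHTED anchored norms `N(m′, |J|)`).  It
is read through `(f, g)` by the weighted prescribed Young inequality of the companion file (`sum_filter_wt_norm_kernel_map_prescribed_le`) and transported to the
Hubbard torus by the plateau identities, the input hypothesis discharged from the COARSE-family WEIGHTED prescribed sizes of `G` (the companion's weighted bridge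
`sum_wt_norm_kernel_sectorPreimage_prescribedSlots_le_of_wt_prescribedSum_le` + the parent-set expansion):

* §1 **`sum_wt_norm_kernel_sectorPreimage_parentSlots_le_of_wt_prescribedSum_le`** (Hubbard, reusable) — the weighted prescribed-leg input hypothesis for the
  sector preimage with PARENT-SET predicates: `≤ ρc^{|T|}·(ε_x·B m′ |T|)`;
* §2 (generic label sets) **`sum_filter_wt_norm_kernel_map_gaussConv_sub_le_binomial_prescribed_of_gramBounded`**;
* §3 (Hubbard torus) **`sum_filter_wt_norm_sectorAnalysis_gaussConv_sub_le_binomial_prescribed_of_plateau`** —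
  `Σ_{X″_i = w″, (X″_j).2 = τ″_j} wt(π″X″)·‖kernel (map (toLin' E(F′)) (e^{Δ_C}G − G)) (2p) X″‖ ≤ cr·cc^{2p−1}·Σ_{m′>p} (2p)!⁻¹(∏_{j∉J}(2m′−j))(2m′)^{|J|} κ^{2m′−2p} N(m′,|J|)`,
  `N(m′, F) := ρc^F·(ε_x·B m′ F)`, weighted overlap costs `(cr, cc)`.

With the companion file this is the complete block step `(Hstep)` of the birth-level tower on the WEIGHTED ALL-KNOWN track (`klTowerBornWtFull`; cell gate-hubbard-kl,
located item «(I2)-WT-ONCLASS», plan g22 (R165)/(R167)).  Everything is proved; no definition, no named fact.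

## Sources

G. Benfatto, A. Giuliani, V. Mastropietro, Ann. Henri Poincaré 7 (2006) 809–898, (2.61)–(2.63), (2.66), (2.70)–(2.71a), §2.8 (2.76)–(2.84), (2.88)–(2.90),
App. A3 Lemma A3.1, §3 (3.2)–(3.8) [`BenfattoGiulianiMastropietro2006`]; K. Gawȩdzki, A. Kupiainen, Comm. Math. Phys. 102 (1985) 1–30, §3 [`GawedzkiKupiainen1985GrossNeveu`].
-/

noncomputable section

namespace Literature.MathematicalPhysics.QuantumLattice

open GrassmannAlgebra Finset Literature.Probability.LatticeModels Literature.Probability.LatticeModels.BattleFederbush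
open scoped Nat

universe u

/-! ### §1 The weighted prescribed-leg input hypothesis for the sector preimage with PARENT-SET predicates -/

section Parents

variable {L M : ℕ} [NeZero L] {N : ℕ} {ι₀ : Type*}

omit [NeZero L] in
/-- Expanding a product of set-membership indicators over the choices (as in the companion files). [folklore] -/
private theorem prod_ite_mem_eq_sum_prod_ite_eq'' {S : Type*} [Fintype ι₀] [DecidableEq ι₀] [DecidableEq S] (Par : ι₀ → Finset S) (v : ι₀ → S) :
    (∏ j, (if v j ∈ Par j then (1 : ℝ) else 0)) = ∑ s ∈ Fintype.piFinset Par, ∏ j, (if v j = s j then (1 : ℝ) else 0) := by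
  have h : ∀ j, (if v j ∈ Par j then (1 : ℝ) else 0) = ∑ y ∈ Par j, (if v j = y then (1 : ℝ) else 0) := fun j => by
    rw [Finset.sum_ite_eq]
  simp_rw [h]
  exact Finset.prod_univ_sum (fun j => Par j) (fun j y => if v j = y then (1 : ℝ) else 0)

/-- **The weighted prescribed-leg suppliers' input hypothesis for the sector preimage, parent-set predicates**: if every WEIGHTED sectorised prescribed sum of `W_F(G)` in
degree `2m′+2` with `F + 1` legs held fixed is `≤ B (m′+1) F` (`wl ≥ 0` a weight on the labelled position sets), then for every slot set `T`, parent sets `Par j` with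
`|Par j| ≤ ρc`, injective `ι` missing `t`, pin `a`:
`Σ_{Y : Y t = a} ‖kernel (sectorPreimage β F G) (2m′+2) Y‖ · wl(Y) · ∏_{j:T} [ (Y (ι j)).2 ∈ Par j ] ≤ ρc^{|T|} · (ε_x · B (m′+1) |T|)`.
[cite: BenfattoGiulianiMastropietro2006, §2.8 (2.88)-(2.90), App. A3 Lemma A3.1] -/
theorem sum_wt_norm_kernel_sectorPreimage_parentSlots_le_of_wt_prescribedSum_le {β : ℝ} (hβ : 0 ≤ β) (F : Fin N → FreqMomentum L M → ℂ)
    (G : HubbardGrassmann L M) (wl : Finset (SpaceTimeIdx L M × SectorLeg N) → ℝ) (hwl : ∀ S, 0 ≤ wl S)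
    (m' : ℕ) (B : ℕ → ℕ → ℝ) (hB0 : ∀ m'' Fc, 0 ≤ B m'' Fc)
    (hB : ∀ (Fc : ℕ) (E : Finset (Fin (2 * m' + 1 + 1))) (τ : Fin (2 * m' + 1 + 1) → SectorLeg N) (q : Fin (2 * m' + 1 + 1)),
      q ∈ E → E.card = Fc + 1 → ∀ y : SpaceTimeIdx L M,
        imagTimeWeight β M ^ (2 * m' + 1) *
          ∑ σ ∈ univ.filter (fun σ : Fin (2 * m' + 1 + 1) → SectorLeg N => ∀ e ∈ E, σ e = τ e),
            ∑ x ∈ univ.filter (fun x : Fin (2 * m' + 1 + 1) → SpaceTimeIdx L M => x q = y),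
              wl (univ.image fun i => (x i, σ i)) * ‖sectorisedKernel L M β F G (2 * m' + 1 + 1) σ x‖ ≤ B (m' + 1) Fc)
    {ρc : ℝ} (T : Finset ι₀) (Par : T → Finset (SectorLeg N)) (hPar : ∀ j, ((Par j).card : ℝ) ≤ ρc)
    (ι : T → Fin (2 * m' + 1 + 1)) (hι : Function.Injective ι) (t : Fin (2 * m' + 1 + 1)) (ht : ∀ j : T, ι j ≠ t)
    (a : SpaceTimeIdx L M × SectorLeg N) :
    ∑ Y ∈ univ.filter (fun Y : Fin (2 * m' + 1 + 1) → SpaceTimeIdx L M × SectorLeg N => Y t = a),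
        ‖kernel ℂ (sectorPreimage β F G) (2 * m' + 1 + 1) Y‖ * wl (univ.image Y) * ∏ j : T, (if (Y (ι j)).2 ∈ Par j then (1 : ℝ) else 0) ≤
      ρc ^ T.card * (imagTimeWeight β M * B (m' + 1) T.card) := by
  classical
  have hε : 0 ≤ imagTimeWeight β M := imagTimeWeight_nonneg hβ M
  simp_rw [prod_ite_mem_eq_sum_prod_ite_eq'' Par, mul_sum]
  rw [sum_comm]
  have hone : ∀ s ∈ Fintype.piFinset Par,
      ∑ Y ∈ univ.filter (fun Y : Fin (2 * m' + 1 + 1) → SpaceTimeIdx L M × SectorLeg N => Y t = a),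
        ‖kernel ℂ (sectorPreimage β F G) (2 * m' + 1 + 1) Y‖ * wl (univ.image Y) * ∏ j : T, (if (Y (ι j)).2 = s j then (1 : ℝ) else 0) ≤
        imagTimeWeight β M * B (m' + 1) T.card := fun s _ =>
    sum_wt_norm_kernel_sectorPreimage_prescribedSlots_le_of_wt_prescribedSum_le hβ F G wl hwl (2 * m' + 1) (Fc := T.card)
      (B := B (m' + 1) T.card) (fun E τ q hq hE y => hB T.card E τ q hq hE y) T rfl ι hι t ht s a
  refine (sum_le_sum hone).trans ?_
  rw [sum_const, nsmul_eq_mul, Fintype.card_piFinset]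
  have hcard : ((∏ j : T, (Par j).card : ℕ) : ℝ) ≤ ρc ^ T.card := by
    rw [Nat.cast_prod, ← Fintype.card_coe T, ← Finset.card_univ, ← prod_const]
    exact prod_le_prod (fun j _ => Nat.cast_nonneg _) fun j _ => hPar j
  exact mul_le_mul_of_nonneg_right hcard (mul_nonneg hε (hB0 _ _))

end Parents

/-! ### §2 Generic label sets: the weighted prescribed first order read through `(f, g)` -/

section Generic

variable {𝕜 : Type*} [RCLike 𝕜] {Γ Γ' Γ'' : Type u} {Λ : Type*} [Fintype Γ] [DecidableEq Γ] [Fintype Γ'] [DecidableEq Γ']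
  [Fintype Γ''] [DecidableEq Γ''] [DecidableEq Λ] {wt : Finset Λ → ℝ}

/-- **First order of the increment, PRESCRIBED output legs, WEIGHTED output positions, read through `(f, g)`, binomial–Gram form** (BGM 2006 (2.61)–(2.63), (2.66) at
first order with (2.70)–(2.71a), (2.88)–(2.90), §3 (3.2)–(3.8)): `Ṽ` even on the auxiliary labels `Γ′`, `C′ = fᵀ C f` replica-Gram-bounded (`κ ≥ 0`); output degree
`2(q+1)`, leg `i ∉ J` pinned at `w″`, legs `j ∈ J` constrained to `P j`, predicates `A j` on `Γ′` inherited through the matrix of `g ∘ f`; the input through its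
`A`-constrained WEIGHTED anchored norms `N(m′, F)`; weighted analysis costs `(cr, cc)`.  Then
`Σ_{X″_i = w″, P j (X″_j)} wt(π″X″)·‖kernel_{2(q+1)}(map g (e^{Δ_C}(map f Ṽ) − map f Ṽ))(X″)‖ ≤ cr·cc^{2q+1}·Σ_{m′ > q+1} (2q+2)!⁻¹(∏_{j∉J}(2m′−j))(2m′)^{|J|}κ^{2m′−2q−2} N(m′, |J|)`.
[cite: BenfattoGiulianiMastropietro2006, (2.61)-(2.63), (2.66), (2.88)-(2.90), (3.2)-(3.8)] -/
theorem sum_filter_wt_norm_kernel_map_gaussConv_sub_le_binomial_prescribed_of_gramBounded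
    (hwt : IsTreeWeight wt) (π' : Γ' → Λ) (π'' : Γ'' → Λ)
    (C : Matrix Γ Γ 𝕜) (f : (Γ' → 𝕜) →ₗ[𝕜] (Γ → 𝕜)) (g : (Γ → 𝕜) →ₗ[𝕜] (Γ'' → 𝕜))
    (Vt : GrassmannAlgebra 𝕜 Γ') (hVt : Vt ∈ evenPart 𝕜 Γ')
    {κ : ℝ} (hκ : 0 ≤ κ) (hGB : IsGramBoundedR ((LinearMap.toMatrix' f).transpose * C * LinearMap.toMatrix' f) κ)
    {q : ℕ} (i : Fin (2 * q + 1 + 1)) (J : Finset (Fin (2 * q + 1 + 1))) (hi : i ∉ J) (P : Fin (2 * q + 1 + 1) → Γ'' → Prop)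
    [∀ j, DecidablePred (P j)] (A : Fin (2 * q + 1 + 1) → Γ' → Bool)
    (hPA : ∀ j ∈ J, ∀ (y'' : Γ'') (x' : Γ'), P j y'' → (LinearMap.toMatrix' g * LinearMap.toMatrix' f) y'' x' ≠ 0 → A j x' = true)
    (N : ℕ → ℕ → ℝ) (hN0 : ∀ m' F, 0 ≤ N m' F)
    (hN : ∀ (m' : ℕ) (T : Finset (Fin (2 * q + 1 + 1))), T ⊆ J → ∀ (ι : T → Fin (2 * m')), Function.Injective ι →
      ∀ (t : Fin (2 * m')), (∀ j, ι j ≠ t) → ∀ a : Γ',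
        ∑ Y ∈ univ.filter (fun Y : Fin (2 * m') → Γ' => Y t = a),
          ‖kernel 𝕜 Vt (2 * m') Y‖ * wt ((univ.image Y).image π') * ∏ j : T, (if A j (Y (ι j)) = true then (1 : ℝ) else 0) ≤ N m' T.card)
    {cr cc : ℝ} (hcc0 : 0 ≤ cc)
    (hrow' : ∀ X'', ∑ X', ‖(LinearMap.toMatrix' g * LinearMap.toMatrix' f) X'' X'‖ * wt {π'' X'', π' X'} ≤ cr)
    (hcol' : ∀ X', ∑ X'', ‖(LinearMap.toMatrix' g * LinearMap.toMatrix' f) X'' X'‖ * wt {π'' X'', π' X'} ≤ cc) (w'' : Γ'') :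
    ∑ X'' ∈ univ.filter (fun X'' : Fin (2 * q + 1 + 1) → Γ'' => X'' i = w'' ∧ ∀ j ∈ J, P j (X'' j)), wt ((univ.image X'').image π'') *
        ‖kernel 𝕜 (ExteriorAlgebra.map g (gaussConv 𝕜 C (ExteriorAlgebra.map f Vt) - ExteriorAlgebra.map f Vt)) (2 * q + 1 + 1) X''‖ ≤
      cr * cc ^ (2 * q + 1) *
        ∑ m' ∈ range (Fintype.card Γ' / 2 + 1), (if q + 1 < m' then
          ((((2 * (q + 1)).factorial : ℝ))⁻¹ * ((∏ j ∈ univ.filter (fun j : Fin (2 * (q + 1)) => j ∉ J), (2 * m' - (j : ℕ)) : ℕ) : ℝ)) *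
            ((2 * m' : ℕ) : ℝ) ^ J.card * κ ^ (2 * m' - 2 * (q + 1)) * N m' J.card else 0) := by
  set C' : Matrix Γ' Γ' 𝕜 := (LinearMap.toMatrix' f).transpose * C * LinearMap.toMatrix' f with hC'
  -- the weight pulled back to the auxiliary labels is a tree weight
  set wt' : Finset Γ' → ℝ := fun S => wt (S.image π') with hwt'
  have hwt'tree : IsTreeWeight wt' := hwt.comap π'
  set Bsum : ℝ := ∑ m' ∈ range (Fintype.card Γ' / 2 + 1), (if q + 1 < m' then
      ((((2 * (q + 1)).factorial : ℝ))⁻¹ * ((∏ j ∈ univ.filter (fun j : Fin (2 * (q + 1)) => j ∉ J), (2 * m' - (j : ℕ)) : ℕ) : ℝ)) *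
        ((2 * m' : ℕ) : ℝ) ^ J.card * κ ^ (2 * m' - 2 * (q + 1)) * N m' J.card else 0) with hBsum
  have hB0 : 0 ≤ Bsum := sum_nonneg fun m' _ => by
    split_ifs
    · exact mul_nonneg (mul_nonneg (mul_nonneg (mul_nonneg (inv_nonneg.2 (Nat.cast_nonneg _)) (Nat.cast_nonneg _))
        (pow_nonneg (Nat.cast_nonneg _) _)) (pow_nonneg hκ _)) (hN0 _ _)
    · exact le_rfl
  -- the abstract weighted prescribed first order in the auxiliary representation, for every pin (degree `2(q+1) = (2q+1)+1`)
  have hK : ∀ a : Γ', ∑ W ∈ univ.filter (fun W : Fin (2 * q + 1 + 1) → Γ' => W i = a ∧ ∀ j ∈ J, A j (W j) = true),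
      ‖kernel 𝕜 (gaussConv 𝕜 C' Vt - Vt) (2 * q + 1 + 1) W‖ * wt ((univ.image W).image π') ≤ Bsum := fun a =>
    le_of_eq_of_le (sum_congr rfl fun W _ => mul_comm _ _)
      (sum_wt_norm_kernel_gaussConv_sub_le_binomial_prescribed_of_gramBounded (C := C') hwt'tree hκ hGB Vt hVt (p := q + 1) J A N hN0 hN i hi a)
  -- read through `g ∘ f`
  have hsub : gaussConv 𝕜 C (ExteriorAlgebra.map f Vt) - ExteriorAlgebra.map f Vt = ExteriorAlgebra.map f (gaussConv 𝕜 C' Vt - Vt) := by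
    rw [gaussConv_map, map_sub]
  rw [hsub, map_map_eq_map_comp]
  exact sum_filter_wt_norm_kernel_map_prescribed_le hwt π' π'' (g ∘ₗ f) hcc0
    (by intro X''; rw [LinearMap.toMatrix'_comp]; exact hrow' X'')
    (by intro X'; simp only [LinearMap.toMatrix'_comp]; exact hcol' X') (gaussConv 𝕜 C' Vt - Vt) (2 * q + 1) i J P A
    (by intro j hj y'' x' hPj hne; rw [LinearMap.toMatrix'_comp] at hne; exact hPA j hj y'' x' hPj hne) hB0 hK w''

end Generic

/-! ### §3 The Hubbard torus: plateau transfer, input discharged from the coarse-family WEIGHTED prescribed sizes -/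

section Transfer

variable {L M : ℕ} [NeZero L] [NeZero M] {N N' : ℕ} {Λ : Type*} [DecidableEq Λ] {wt : Finset Λ → ℝ}

/-- **The FIRST-ORDER increment of the sectorised kernels across one slice, binomial–Gram form, PRESCRIBED output legs, WEIGHTED output positions — the weighted
ALL-KNOWN track** (BGM 2006 (2.61)–(2.63), (2.66), first order; §2.8 (2.82)–(2.84), (2.88)–(2.90), App. A3 Lemma A3.1; §3 (3.2)–(3.8)).  Data as in
`sum_filter_wt_norm_sectorAnalysis_effAction_sub_gaussConv_le_graded_prescribed_of_plateau` (tree weight `wt`, position maps `π, π″`; thin/fat input families with the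
plateau of `F` over `supp C` and `F′`; parents relation `child`, `≤ ρc` parents per fine label; ANY even input `G`; WEIGHTED coarse-family prescribed sizes `B m′ F` of `G`;
sectorised covariance replica-Gram-bounded, `κ ≥ 0`; WEIGHTED overlap costs `(cr, cc)`); output degree `2(q+1)`, leg `i ∉ J` pinned at `w″`, fine labels `τ″_j` prescribed
on `j ∈ J`.  Then `Σ_{X″_i = w″, (X″_j).2 = τ″_j} wt(π″X″)·‖kernel (map (toLin' E(F′)) (e^{Δ_C}G − G)) (2q+2) X″‖ ≤
cr·cc^{2q+1}·Σ_{m′ > q+1} (2q+2)!⁻¹(∏_{j∉J}(2m′−j))(2m′)^{|J|}κ^{2m′−2q−2}·(ρc^{|J|}·ε_x·B m′ |J|)`.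
[cite: BenfattoGiulianiMastropietro2006, (2.61)-(2.63), (2.66), (2.88)-(2.90), App. A3 Lemma A3.1, (3.2)-(3.8)] -/
theorem sum_filter_wt_norm_sectorAnalysis_gaussConv_sub_le_binomial_prescribed_of_plateau
    (hwt : IsTreeWeight wt) (π : SpaceTimeIdx L M × SectorLeg N → Λ) (π'' : SpaceTimeIdx L M × SectorLeg N' → Λ)
    {β : ℝ} (hβ : 0 < β) (F Ft : Fin N → FreqMomentum L M → ℂ) (hFF : ∀ ω k, Ft ω k * F ω k = F ω k)
    (hF0 : ∀ k, ∑ ω, F ω k = 0 → ∀ ω, F ω k = 0)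
    (F' : Fin N' → FreqMomentum L M → ℂ) (G : HubbardGrassmann L M) (hG : G ∈ evenPart ℂ (HubbardFieldIdx L M))
    (C : Matrix (HubbardFieldIdx L M) (HubbardFieldIdx L M) ℂ)
    (hCpl : ∀ X Y, C X Y ≠ 0 → ∑ ω, F ω X.1.1 = 1 ∧ ∑ ω, F ω Y.1.1 = 1)
    (hF'pl : ∀ (ω' : Fin N') (k : FreqMomentum L M), F' ω' k ≠ 0 → ∑ ω, F ω k = 1)
    (child : Fin N' → Fin N → Prop) [DecidableRel child]
    (hvan : ∀ (X'' : SpaceTimeIdx L M × SectorLeg N') (X' : SpaceTimeIdx L M × SectorLeg N),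
      (sectorAnalysisMatrix L M β F' * sectorSubMatrix L M β Ft) X'' X' ≠ 0 →
        child X''.2.1.1 X'.2.1.1 ∧ X'.2.1.2 = X''.2.1.2 ∧ X'.2.2 = X''.2.2)
    {ρc : ℝ} (hρc0 : 0 ≤ ρc)
    (hρc : ∀ ℓ'' : SectorLeg N',
      (((univ.filter fun ℓ' : SectorLeg N => child ℓ''.1.1 ℓ'.1.1 ∧ ℓ'.1.2 = ℓ''.1.2 ∧ ℓ'.2 = ℓ''.2).card : ℝ)) ≤ ρc)
    {κ : ℝ} (hκ : 0 ≤ κ)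
    (hGB : IsGramBoundedR ((sectorSubMatrix L M β Ft).transpose * C * sectorSubMatrix L M β Ft) κ)
    (B : ℕ → ℕ → ℝ) (hB0 : ∀ m' Fc, 0 ≤ B m' Fc)
    (hB : ∀ (m' Fc : ℕ) (E : Finset (Fin (2 * m' + 1 + 1))) (τ : Fin (2 * m' + 1 + 1) → SectorLeg N) (q : Fin (2 * m' + 1 + 1)),
      q ∈ E → E.card = Fc + 1 → ∀ y : SpaceTimeIdx L M,
        imagTimeWeight β M ^ (2 * m' + 1) *
          ∑ σ ∈ univ.filter (fun σ : Fin (2 * m' + 1 + 1) → SectorLeg N => ∀ e ∈ E, σ e = τ e),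
            ∑ x ∈ univ.filter (fun x : Fin (2 * m' + 1 + 1) → SpaceTimeIdx L M => x q = y),
              wt ((univ.image fun i => (x i, σ i)).image π) * ‖sectorisedKernel L M β F G (2 * m' + 1 + 1) σ x‖ ≤ B (m' + 1) Fc)
    {cr cc : ℝ} (hcc0 : 0 ≤ cc)
    (hrow' : ∀ X'', ∑ X', ‖(sectorAnalysisMatrix L M β F' * sectorSubMatrix L M β Ft) X'' X'‖ * wt {π'' X'', π X'} ≤ cr)
    (hcol' : ∀ X', ∑ X'', ‖(sectorAnalysisMatrix L M β F' * sectorSubMatrix L M β Ft) X'' X'‖ * wt {π'' X'', π X'} ≤ cc)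
    {q : ℕ} (i : Fin (2 * q + 1 + 1)) (J : Finset (Fin (2 * q + 1 + 1))) (hi : i ∉ J) (τ'' : Fin (2 * q + 1 + 1) → SectorLeg N')
    (w'' : SpaceTimeIdx L M × SectorLeg N') :
    ∑ X'' ∈ univ.filter (fun X'' : Fin (2 * q + 1 + 1) → SpaceTimeIdx L M × SectorLeg N' => X'' i = w'' ∧ ∀ j ∈ J, (X'' j).2 = τ'' j),
        wt ((univ.image X'').image π'') *
          ‖kernel ℂ (ExteriorAlgebra.map (Matrix.toLin' (sectorAnalysisMatrix L M β F')) (gaussConv ℂ C G - G)) (2 * q + 1 + 1) X''‖ ≤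
      cr * cc ^ (2 * q + 1) *
        ∑ m' ∈ range (Fintype.card (SpaceTimeIdx L M × SectorLeg N) / 2 + 1), (if q + 1 < m' then
          ((((2 * (q + 1)).factorial : ℝ))⁻¹ * ((∏ j ∈ univ.filter (fun j : Fin (2 * (q + 1)) => j ∉ J), (2 * m' - (j : ℕ)) : ℕ) : ℝ)) *
            ((2 * m' : ℕ) : ℝ) ^ J.card * κ ^ (2 * m' - 2 * (q + 1)) * (ρc ^ J.card * (imagTimeWeight β M * B m' J.card)) else 0) := by
  classical
  have hε : 0 ≤ imagTimeWeight β M := imagTimeWeight_nonneg hβ.le M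
  have hwl : ∀ S : Finset (SpaceTimeIdx L M × SectorLeg N), 0 ≤ wt (S.image π) := fun S => zero_le_one.trans (hwt.one_le _)
  -- the parents of a fine label and the inherited predicates
  set Par : SectorLeg N' → Finset (SectorLeg N) :=
    fun ℓ'' => univ.filter fun ℓ' : SectorLeg N => child ℓ''.1.1 ℓ'.1.1 ∧ ℓ'.1.2 = ℓ''.1.2 ∧ ℓ'.2 = ℓ''.2 with hPar
  set A : Fin (2 * q + 1 + 1) → SpaceTimeIdx L M × SectorLeg N → Bool := fun j X' => decide (X'.2 ∈ Par (τ'' j)) with hA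
  set Np : ℕ → ℕ → ℝ := fun m' Fc => ρc ^ Fc * (imagTimeWeight β M * B m' Fc) with hNp
  have hNp0 : ∀ m' Fc, 0 ≤ Np m' Fc := fun m' Fc => mul_nonneg (pow_nonneg hρc0 _) (mul_nonneg hε (hB0 _ _))
  -- the input hypothesis for `Ṽ = sectorPreimage β F G` (§1)
  have hN : ∀ (m' : ℕ) (T : Finset (Fin (2 * q + 1 + 1))), T ⊆ J → ∀ (ι : T → Fin (2 * m')), Function.Injective ι →
      ∀ (t : Fin (2 * m')), (∀ j, ι j ≠ t) → ∀ a : SpaceTimeIdx L M × SectorLeg N,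
        ∑ Y ∈ univ.filter (fun Y : Fin (2 * m') → SpaceTimeIdx L M × SectorLeg N => Y t = a),
          ‖kernel ℂ (sectorPreimage β F G) (2 * m') Y‖ * wt ((univ.image Y).image π) *
            ∏ j : T, (if A j (Y (ι j)) = true then (1 : ℝ) else 0) ≤ Np m' T.card := by
    intro m' T _
    rcases m' with _ | m'
    · intro ι _ t
      exact Fin.elim0 (Fin.cast (Nat.mul_zero 2) t)
    · rw [show 2 * (m' + 1) = 2 * m' + 1 + 1 by ring]
      intro ι hι t ht a
      have h := sum_wt_norm_kernel_sectorPreimage_parentSlots_le_of_wt_prescribedSum_le hβ.le F G (fun S => wt (S.image π)) hwl m' B hB0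
        (fun Fc E τ q' hq hE y => hB m' Fc E τ q' hq hE y) T (fun j : T => Par (τ'' j)) (fun j => hρc (τ'' j)) ι hι t ht a
      refine le_of_eq_of_le (sum_congr rfl fun Y _ => ?_) h
      congr 1
      refine prod_congr rfl fun j _ => ?_
      simp only [hA, decide_eq_true_eq]
  -- the inherited predicates: a fine label only overlaps its parents
  have hPA : ∀ j ∈ J, ∀ (y'' : SpaceTimeIdx L M × SectorLeg N') (x' : SpaceTimeIdx L M × SectorLeg N),
      (fun (j : Fin (2 * q + 1 + 1)) (X'' : SpaceTimeIdx L M × SectorLeg N') => X''.2 = τ'' j) j y'' →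
        (LinearMap.toMatrix' (Matrix.toLin' (sectorAnalysisMatrix L M β F')) *
            LinearMap.toMatrix' (Matrix.toLin' (sectorSubMatrix L M β Ft))) y'' x' ≠ 0 → A j x' = true := by
    intro j _ y'' x' hPj hne
    rw [LinearMap.toMatrix'_toLin', LinearMap.toMatrix'_toLin'] at hne
    obtain ⟨h1, h2, h3⟩ := hvan y'' x' hne
    have hPj' : y''.2 = τ'' j := hPj
    simp only [hA, hPar, decide_eq_true_eq, mem_filter, mem_univ, true_and, ← hPj']
    exact ⟨h1, h2, h3⟩
  -- transfer: inside `E(F′)` replace `G` by `map S Ṽ`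
  have hid := map_sectorAnalysis_map_sectorPreimage_of_plateau hβ.ne' F Ft hFF hF0 F' G hF'pl
  have hgc := map_sectorAnalysis_gaussConv_map_sectorPreimage_of_plateau hβ.ne' F Ft hFF hF0 F' G C hCpl hF'pl
  have hrepl : ExteriorAlgebra.map (Matrix.toLin' (sectorAnalysisMatrix L M β F')) (gaussConv ℂ C G - G) =
      ExteriorAlgebra.map (Matrix.toLin' (sectorAnalysisMatrix L M β F'))
        (gaussConv ℂ C (ExteriorAlgebra.map (Matrix.toLin' (sectorSubMatrix L M β Ft)) (sectorPreimage β F G)) -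
          ExteriorAlgebra.map (Matrix.toLin' (sectorSubMatrix L M β Ft)) (sectorPreimage β F G)) := by
    rw [map_sub, map_sub, hid, hgc]
  rw [hrepl]
  exact sum_filter_wt_norm_kernel_map_gaussConv_sub_le_binomial_prescribed_of_gramBounded hwt π π'' C (Matrix.toLin' (sectorSubMatrix L M β Ft))
    (Matrix.toLin' (sectorAnalysisMatrix L M β F')) (sectorPreimage β F G) (sectorPreimage_mem_evenPart β F hG) hκ
    (by simpa only [LinearMap.toMatrix'_toLin'] using hGB) i J hi (fun j X'' => X''.2 = τ'' j) A hPA Np hNp0 hN hcc0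
    (by simpa only [LinearMap.toMatrix'_toLin'] using hrow') (by simpa only [LinearMap.toMatrix'_toLin'] using hcol') w''

end Transfer

end Literature.MathematicalPhysics.QuantumLattice

end
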